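import Mathlib.Analysis.Complex.LocallyUniformLimit
import Mathlib.Analysis.Complex.Convex
import Mathlib.Analysis.Complex.Polynomial.Basic
import Mathlib.Analysis.Calculus.ParametricIntegral
import Mathlib.Analysis.SpecialFunctions.Pow.Real
import Mathlib.MeasureTheory.Integral.Bochner.Basic
import Mathlib.Algebra.Polynomial.Taylor
import Literature.Analysis.Complex.Hurwitz
import HarnessLib

/-!
# de Bruijn's universal factors: roots of trigonometric integrals (de Bruijn 1950, §§2–3)

Trunk T-ANT support (complex analysis), serving `Literature/NumberTheory/LFunctions/DeBruijnNewman`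
(the programme to discharge de Bruijn's monotonicity theorem
`Literature.NumberTheory.LFunctions.HasOnlyRealZeros.mono_deBruijnH` = de Bruijn 1950, Thm. 13 with `Δ = 0`).

N. G. de Bruijn, *The roots of trigonometric integrals*, Duke Math. J. **17** (1950), 197–226,
studies the *trigonometric integrals* `f(z) = ∫_ℝ F(t) e^{izt} dt` (`Literature.trigIntegral F`) of
kernels `F` with `F(−t) = F(t)^*` and `F(t) = O(e^{−|t|^b})`, `b > 2` (his (3.4)–(3.5), Thm. 10;
`Literature.DeBruijn1950.IsAdmissible F`), and the *universal factors* `S(t)` such that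
`∫ F(t) S(t) e^{izt} dt` keeps its roots in the strip `|Im z| ≤ Δ` (`Literature.Analysis.Complex.RootsInStrip`).

## Contents

Vendored statements (named facts, nothing asserted; users take `(h : <name>)`):

* `Literature.Analysis.Complex.DeBruijn1950.thm6` — **Thm. 6** (p. 202): a real entire function of order `< 2` whose roots
  lie in `|Im z| ≤ Δ` is the locally uniform limit of real polynomials with roots in that strip
  (Hadamard factorisation of genus `≤ 1` + `e^{az} = lim (1 + az/n)ⁿ`). This is the deep input.
* `Literature.Analysis.Complex.DeBruijn1950.thm10` — **Thm. 10** (p. 204, Pólya): for admissible `F`, `trigIntegral F` is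
  a real entire function of order `< 2`.
* `Literature.Analysis.Complex.DeBruijn1950.thm13` — **Thm. 13** (p. 205): for admissible `F`, if the roots of
  `trigIntegral F` lie in `|Im z| ≤ Δ` then those of `trigIntegral (F · e^{λ²t²/2})` lie in
  `|Im z| ≤ √max(Δ² − λ², 0)`.

Proved here (the elementary layers of de Bruijn's argument):

* `Literature.Analysis.Complex.differentiable_trigIntegral`: `trigIntegral F` is entire when all exponential moments
  `∫ ‖F(t)‖ e^{c|t|} dt` are finite (differentiation under the integral sign);
* `Literature.Analysis.Complex.DeBruijn1950.thm3_real` — **Lemma 1 / Thm. 3** (pp. 200–201) in the case `Δᵢ = 0`, `ξ = 1`: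
  if a complex polynomial `p ≠ 0` has only real roots and `λ ≥ 0`, then
  `p(z + iλ) + p(z − iλ)` is `≠ 0` and has only real roots (`Literature.Analysis.Complex.DeBruijn1950.jensenShift`);
* `Literature.Analysis.Complex.rootsInStrip_of_tendstoLocallyUniformly` — **Thm. 7** (p. 203, Hurwitz) as used by de Bruijn:
  a locally uniform limit `f ≢ 0` of entire functions with roots in a closed strip has its roots
  in that strip (from `Complex.hurwitz_eqOn_zero_or_forall_ne_zero` on the two open half-planes).

## References

* N. G. de Bruijn, *The roots of trigonometric integrals*, Duke Math. J. 17 (1950), 197–226: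
  Lemma 1, Thms. 3–8 (§§2–3), Thm. 10, Thm. 13.
* G. Pólya, *Über trigonometrische Integrale mit nur reellen Nullstellen*, J. reine angew. Math.
  158 (1927), 6–18 (Thm. 10 and the universal factors).
* J. B. Conway, *Functions of one complex variable I*, 2nd ed., Ch. VII, Thm. 2.5 (Hurwitz).
-/

noncomputable section

open Complex MeasureTheory Filter Metric Set Topology Polynomial

namespace Literature.Analysis.Complex

/-! ## Basic notions -/

/-- `RootsInStrip f Δ`: every root `z` of `f : ℂ → ℂ` satisfies `|Im z| ≤ Δ` (de Bruijn 1950,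
§1: "the roots lie in the strip `|Im z| ≤ Δ`"; `Δ = 0` means: only real roots). [cite: Bruijn1950, §1] -/
def RootsInStrip (f : ℂ → ℂ) (Δ : ℝ) : Prop :=
  ∀ z : ℂ, f z = 0 → |z.im| ≤ Δ

/-- `RootsInStrip f 0` says exactly that all roots are real. [folklore] -/
theorem rootsInStrip_zero_iff (f : ℂ → ℂ) : RootsInStrip f 0 ↔ ∀ z : ℂ, f z = 0 → z.im = 0 := by
  simp [RootsInStrip, abs_nonpos_iff]

/-- Monotonicity in the width. [folklore] -/
theorem RootsInStrip.mono {f : ℂ → ℂ} {Δ Δ' : ℝ} (h : RootsInStrip f Δ) (hΔ : Δ ≤ Δ') :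
    RootsInStrip f Δ' := fun z hz ↦ (h z hz).trans hΔ

/-- A function with roots in some strip is not identically zero. [folklore] -/
theorem RootsInStrip.exists_ne_zero {f : ℂ → ℂ} {Δ : ℝ} (h : RootsInStrip f Δ) : ∃ z, f z ≠ 0 := by
  by_contra hcon
  push Not at hcon
  have := h ((|Δ| + 1 : ℝ) * I) (hcon _)
  simp only [mul_im, ofReal_re, I_im, mul_one, ofReal_im, I_re, mul_zero, add_zero] at this
  have h1 : |(|Δ| + 1 : ℝ)| = |Δ| + 1 := abs_of_pos (by positivity)
  rw [h1] at this
  linarith [le_abs_self Δ]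

/-- Entire of order `< ρ₀` (quantitative form): `f` is entire and `‖f z‖ ≤ C exp(‖z‖^ρ)` for some
`ρ < ρ₀` (de Bruijn 1950, p. 202: "`|f(z)| < exp(|z|^ρ)`, `ρ < 2`, for `|z|` sufficiently large";
cf. `Literature.Analysis.TotalPositivity.IsEntireOfOrderLtOne`). [cite: Bruijn1950, §3 p. 202] -/
def IsEntireOfOrderLt (ρ₀ : ℝ) (f : ℂ → ℂ) : Prop :=
  Differentiable ℂ f ∧ ∃ ρ C : ℝ, ρ < ρ₀ ∧ ∀ z : ℂ, ‖f z‖ ≤ C * Real.exp (‖z‖ ^ ρ)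

/-- `f` is *real*: real on the real axis (de Bruijn 1950, p. 200: `f = f^*`). [cite: Bruijn1950, §1 p. 200] -/
def IsRealOnReal (f : ℂ → ℂ) : Prop :=
  ∀ x : ℝ, (f x).im = 0

/-- de Bruijn's *trigonometric integral* `f(z) = ∫_ℝ F(t) e^{izt} dt` of a kernel `F : ℝ → ℂ`
(de Bruijn 1950, (1.5)/(3.6)); a Bochner integral, `= 0` when not integrable. [cite: Bruijn1950, eq. (3.6)] -/
def trigIntegral (F : ℝ → ℂ) (z : ℂ) : ℂ :=
  ∫ t : ℝ, F t * Complex.exp (I * z * t)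

namespace DeBruijn1950

/-- de Bruijn's hypotheses on a kernel `F` (Thm. 10, (3.4)–(3.5)): `F` is integrable over `ℝ`,
`F(−t) = F(t)^*` for all real `t`, and `F(t) = O(e^{−|t|^b})` as `t → ±∞` for some `b > 2`.
[cite: Bruijn1950, Thm. 10] -/
structure IsAdmissible (F : ℝ → ℂ) : Prop where
  integrable : Integrable F
  conj_symm : ∀ t : ℝ, F (-t) = (starRingEnd ℂ) (F t)
  decay : ∃ b C : ℝ, 2 < b ∧ ∀ᶠ t in cocompact ℝ, ‖F t‖ ≤ C * Real.exp (-|t| ^ b)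

/-! ## Named facts (de Bruijn 1950, Thms. 6, 10, 13) -/

/-- NAMED FACT (**de Bruijn 1950, Thm. 6**, p. 202). If the real entire function `f` has order
`< 2` and its roots lie in the strip `|Im z| ≤ Δ` (`Δ ≥ 0`), then there is a sequence of real
polynomials `fₙ` whose roots lie in that strip with `fₙ → f` uniformly on bounded sets. (Proof in
the source: Hadamard's factorisation `f = A zᵐ e^{az} ∏ (1 − z/ρ)e^{z/ρ}` with `∑ |ρ|⁻² < ∞`, and
`e^{az} = lim (1 + az/n)ⁿ`.) Users take `(h : DeBruijn1950.thm6)`. [cite: Bruijn1950, Thm. 6] -/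
def thm6 : Prop :=
  ∀ (f : ℂ → ℂ) (Δ : ℝ), 0 ≤ Δ → IsEntireOfOrderLt 2 f → IsRealOnReal f → RootsInStrip f Δ →
    ∃ p : ℕ → Polynomial ℝ,
      (∀ n, RootsInStrip (fun z ↦ ((p n).map (algebraMap ℝ ℂ)).eval z) Δ) ∧
      TendstoLocallyUniformly (fun n z ↦ ((p n).map (algebraMap ℝ ℂ)).eval z) f atTop

/-- NAMED FACT (**de Bruijn 1950, Thm. 10**, p. 204; Pólya 1927). If `F` is integrable,
`F(−t) = F(t)^*` and `F(t) = O(e^{−|t|^b})` for some `b > 2`, then the trigonometric integral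
`f(z) = ∫ F(t) e^{izt} dt` is a real entire function of order `< 2`.
Users take `(h : DeBruijn1950.thm10)`. [cite: Bruijn1950, Thm. 10] -/
def thm10 : Prop :=
  ∀ F : ℝ → ℂ, IsAdmissible F → IsEntireOfOrderLt 2 (trigIntegral F) ∧ IsRealOnReal (trigIntegral F)

/-- NAMED FACT (**de Bruijn 1950, Thm. 13**, p. 205: the universal factor `e^{λ²t²/2}`). If `F`
satisfies the conditions of Thm. 10 and all roots of `f(z) = ∫ F(t) e^{izt} dt` lie in the strip
`|Im z| ≤ Δ`, then all roots of `g(z) = ∫ F(t) e^{λ²t²/2} e^{izt} dt` lie in the strip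
`|Im z| ≤ √max(Δ² − λ², 0)`. (With `Δ = 0`: real roots stay real — de Bruijn's monotonicity for
`H_t`.) Users take `(h : DeBruijn1950.thm13)`. [cite: Bruijn1950, Thm. 13] -/
def thm13 : Prop :=
  ∀ (F : ℝ → ℂ) (Δ lam : ℝ), 0 ≤ Δ → IsAdmissible F → RootsInStrip (trigIntegral F) Δ →
    RootsInStrip (trigIntegral fun t ↦ F t * (Real.exp (lam ^ 2 * t ^ 2 / 2) : ℝ))
      (Real.sqrt (max (Δ ^ 2 - lam ^ 2) 0))

end DeBruijn1950

/-! ## The trigonometric integral is entire under exponential moments -/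

/-- `‖e^{izt}‖ ≤ e^{‖z‖ |t|}` for real `t`. [folklore] -/
theorem norm_cexp_I_mul_mul_le (z : ℂ) (t : ℝ) :
    ‖Complex.exp (I * z * t)‖ ≤ Real.exp (‖z‖ * |t|) := by
  rw [Complex.norm_exp]
  apply Real.exp_le_exp.2
  have h1 : (I * z * t).re = -(z.im * t) := by simp [mul_re, mul_im]
  rw [h1]
  calc -(z.im * t) ≤ |z.im * t| := neg_le_abs _
    _ = |z.im| * |t| := abs_mul _ _
    _ ≤ ‖z‖ * |t| := by gcongr; exact abs_im_le_norm z

/-- The integrand `F(t) e^{izt}` is integrable when the `‖z‖`-th exponential moment of `F` is.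
[folklore] -/
theorem integrable_mul_cexp_of_exp_moment {F : ℝ → ℂ} (hFm : AEStronglyMeasurable F)
    (z : ℂ) (hexp : Integrable fun t ↦ ‖F t‖ * Real.exp (‖z‖ * |t|)) :
    Integrable fun t : ℝ ↦ F t * Complex.exp (I * z * t) := by
  refine Integrable.mono' hexp (hFm.mul (by fun_prop)) (Eventually.of_forall fun t ↦ ?_)
  rw [norm_mul]
  gcongr
  exact norm_cexp_I_mul_mul_le z t

/-- **Differentiation under the integral sign for `trigIntegral`.** If `F` is (a.e. strongly)
measurable and all exponential moments `∫ ‖F(t)‖ e^{c|t|} dt` are finite, then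
`f(z) = ∫ F(t) e^{izt} dt` has derivative `∫ F(t) (it) e^{izt} dt` at every `z`. [folklore] -/
theorem hasDerivAt_trigIntegral {F : ℝ → ℂ} (hFm : AEStronglyMeasurable F)
    (hexp : ∀ c : ℝ, Integrable fun t ↦ ‖F t‖ * Real.exp (c * |t|)) (z₀ : ℂ) :
    HasDerivAt (trigIntegral F) (∫ t : ℝ, F t * (I * t) * Complex.exp (I * z₀ * t)) z₀ := by
  have hs : ball z₀ 1 ∈ 𝓝 z₀ := ball_mem_nhds z₀ one_pos
  refine (hasDerivAt_integral_of_dominated_loc_of_deriv_le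
    (F := fun z t ↦ F t * Complex.exp (I * z * t))
    (F' := fun z t ↦ F t * (I * t) * Complex.exp (I * z * t))
    (bound := fun t ↦ ‖F t‖ * Real.exp ((‖z₀‖ + 2) * |t|)) hs ?_ ?_ ?_ ?_ (hexp _) ?_).2
  · exact Eventually.of_forall fun z ↦ hFm.mul (by fun_prop)
  · exact integrable_mul_cexp_of_exp_moment hFm z₀ (hexp _)
  · exact (hFm.mul (by fun_prop)).mul (by fun_prop)
  · refine Eventually.of_forall fun t z hz ↦ ?_
    have hz' : ‖z‖ ≤ ‖z₀‖ + 1 := by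
      have := mem_ball_iff_norm.1 hz
      calc ‖z‖ = ‖z₀ + (z - z₀)‖ := by ring_nf
        _ ≤ ‖z₀‖ + ‖z - z₀‖ := norm_add_le _ _
        _ ≤ ‖z₀‖ + 1 := by linarith
    have ht : |t| ≤ Real.exp |t| := by linarith [Real.add_one_le_exp |t|]
    simp only [norm_mul, Complex.norm_I, one_mul, Complex.norm_real, Real.norm_eq_abs]
    rw [mul_assoc]
    gcongr
    calc |t| * ‖Complex.exp (I * z * t)‖ ≤ Real.exp |t| * Real.exp (‖z‖ * |t|) := by
          gcongr; exact norm_cexp_I_mul_mul_le z t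
      _ = Real.exp ((‖z‖ + 1) * |t|) := by rw [← Real.exp_add]; ring_nf
      _ ≤ Real.exp ((‖z₀‖ + 2) * |t|) :=
          Real.exp_le_exp.2 (mul_le_mul_of_nonneg_right (by linarith) (abs_nonneg t))
  · refine Eventually.of_forall fun t z _ ↦ ?_
    have h1 : HasDerivAt (fun w : ℂ ↦ I * w * t) (I * t) z := by
      simpa using ((hasDerivAt_id z).const_mul I).mul_const (t : ℂ)
    have h2 : HasDerivAt (fun w : ℂ ↦ F t * Complex.exp (I * w * t))
        (F t * (Complex.exp (I * z * t) * (I * t))) z := (h1.cexp).const_mul (F t)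
    have h3 : F t * (Complex.exp (I * z * t) * (I * t)) = F t * (I * t) * Complex.exp (I * z * t) := by
      ring
    exact h3 ▸ h2

/-- `trigIntegral F` is entire when all exponential moments of `F` are finite (in particular for
de Bruijn's admissible kernels with `F` continuous). [folklore] -/
theorem differentiable_trigIntegral {F : ℝ → ℂ} (hFm : AEStronglyMeasurable F)
    (hexp : ∀ c : ℝ, Integrable fun t ↦ ‖F t‖ * Real.exp (c * |t|)) :
    Differentiable ℂ (trigIntegral F) := fun z ↦
  (hasDerivAt_trigIntegral hFm hexp z).differentiableAt

/-! ## Hurwitz: roots of locally uniform limits stay in a closed strip (de Bruijn's Thm. 7) -/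

/-- Zero-freeness passes to locally uniform limits on an open preconnected set avoiding the
roots, unless the (entire) limit vanishes identically. [cite: Conway1978, Ch. VII Thm. 2.5] -/
theorem forall_ne_zero_of_tendstoLocallyUniformly {ι : Type*} {l : Filter ι} [l.NeBot]
    {F : ι → ℂ → ℂ} {f : ℂ → ℂ} (hF : ∀ᶠ n in l, Differentiable ℂ (F n))
    (hlim : TendstoLocallyUniformly F f l) (hf : ∃ z, f z ≠ 0) {U : Set ℂ} (hU : IsOpen U)
    (hU' : IsPreconnected U) (h0 : ∀ᶠ n in l, ∀ z ∈ U, F n z ≠ 0) : ∀ z ∈ U, f z ≠ 0 := by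
  have hlim' : TendstoLocallyUniformlyOn F f l univ := tendstoLocallyUniformlyOn_univ.2 hlim
  have hdiff : Differentiable ℂ f := fun z ↦
    (hlim'.differentiableOn (hF.mono fun n hn ↦ hn.differentiableOn) isOpen_univ).differentiableAt
      (univ_mem' fun _ ↦ trivial)
  rcases Complex.hurwitz_eqOn_zero_or_forall_ne_zero hU hU'
      (hF.mono fun n hn ↦ hn.differentiableOn) (hlim'.mono (subset_univ U)) h0.frequently with
    h | h
  · -- `f ≡ 0` on the open set `U`; if `U` is empty there is nothing to prove, else identity thm.
    intro z hz
    exfalso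
    obtain ⟨w, hw⟩ := hf
    have han : AnalyticOnNhd ℂ f univ := (hdiff.differentiableOn).analyticOnNhd isOpen_univ
    have hev : f =ᶠ[𝓝 z] 0 :=
      Filter.eventuallyEq_of_mem (hU.mem_nhds hz) h
    have := han.eqOn_zero_of_preconnected_of_eventuallyEq_zero isPreconnected_univ
      (mem_univ z) hev (mem_univ w)
    exact hw this
  · exact h

/-- **Hurwitz's theorem in de Bruijn's form (de Bruijn 1950, Thm. 7, for closed strips).** If
entire functions `Fₙ → f` locally uniformly on `ℂ`, the roots of each `Fₙ` (eventually) lie in the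
strip `|Im z| ≤ Δ`, and `f ≢ 0`, then the roots of `f` lie in that strip.
[cite: Bruijn1950, Thm. 7] -/
theorem rootsInStrip_of_tendstoLocallyUniformly {ι : Type*} {l : Filter ι} [l.NeBot]
    {F : ι → ℂ → ℂ} {f : ℂ → ℂ} {Δ : ℝ} (hF : ∀ᶠ n in l, Differentiable ℂ (F n))
    (hlim : TendstoLocallyUniformly F f l) (hroots : ∀ᶠ n in l, RootsInStrip (F n) Δ)
    (hf : ∃ z, f z ≠ 0) : RootsInStrip f Δ := by
  intro z hz
  by_contra hcon
  push Not at hcon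
  rcases lt_or_ge 0 z.im with hpos | hnonpos
  · -- upper half-plane `{Δ < Im}`
    have hzU : z ∈ {w : ℂ | Δ < w.im} := by
      simp only [mem_setOf_eq]; rwa [abs_of_pos hpos] at hcon
    have h0 : ∀ᶠ n in l, ∀ w ∈ {w : ℂ | Δ < w.im}, F n w ≠ 0 := by
      filter_upwards [hroots] with n hn w hw hFw
      have h1 := hn w hFw
      have h2 : Δ < w.im := hw
      linarith [le_abs_self w.im]
    exact forall_ne_zero_of_tendstoLocallyUniformly hF hlim hf
      (isOpen_lt continuous_const Complex.continuous_im) (convex_halfSpace_im_gt Δ).isPreconnected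
      h0 z hzU hz
  · -- lower half-plane `{Im < -Δ}`
    have hzU : z ∈ {w : ℂ | w.im < -Δ} := by
      simp only [mem_setOf_eq]; rw [abs_of_nonpos hnonpos] at hcon; linarith
    have h0 : ∀ᶠ n in l, ∀ w ∈ {w : ℂ | w.im < -Δ}, F n w ≠ 0 := by
      filter_upwards [hroots] with n hn w hw hFw
      have h1 := hn w hFw
      have h2 : w.im < -Δ := hw
      linarith [neg_abs_le w.im]
    exact forall_ne_zero_of_tendstoLocallyUniformly hF hlim hf
      (isOpen_lt Complex.continuous_im continuous_const) (convex_halfSpace_im_lt (-Δ)).isPreconnected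
      h0 z hzU hz

/-! ## de Bruijn's Lemma 1 / Theorem 3 for polynomials with real roots -/

namespace DeBruijn1950

/-- **de Bruijn 1950, Lemma 1** (p. 200) with `Δ = 0`: for `b` real and `λ > 0`,
`|w + iλ − b|² − |w − iλ − b|² = 4 λ Im w`. [cite: Bruijn1950, Lemma 1] -/
theorem normSq_add_sub_normSq_sub (w : ℂ) (b lam : ℝ) :
    Complex.normSq (w + I * lam - b) - Complex.normSq (w - I * lam - b) = 4 * lam * w.im := by
  simp only [Complex.normSq_apply, add_re, sub_re, mul_re, I_re, ofReal_re, zero_mul, I_im,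
    ofReal_im, mul_zero, sub_zero, add_im, sub_im, mul_im, one_mul, zero_add, add_zero]
  ring

/-- For `Im w > 0`, `λ > 0`, `b` real: `‖w − iλ − b‖ < ‖w + iλ − b‖`. [cite: Bruijn1950, Lemma 1] -/
theorem norm_sub_lt_norm_add {w : ℂ} (hw : 0 < w.im) (b : ℝ) {lam : ℝ} (hlam : 0 < lam) :
    ‖w - I * lam - b‖ < ‖w + I * lam - b‖ := by
  have h := normSq_add_sub_normSq_sub w b lam
  have hpos : 0 < 4 * lam * w.im := by positivity
  rw [← sq_lt_sq₀ (norm_nonneg _) (norm_nonneg _), ← Complex.normSq_eq_norm_sq,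
    ← Complex.normSq_eq_norm_sq]
  linarith

/-- Strict monotonicity of products over a nonempty multiset: `0 ≤ f b < g b` for all `b` gives
`∏ f < ∏ g`. [folklore] -/
theorem multiset_prod_map_lt {α : Type*} (s : Multiset α) (hs : s ≠ 0) (f g : α → ℝ)
    (hf : ∀ b, 0 ≤ f b) (hfg : ∀ b, f b < g b) : (s.map f).prod < (s.map g).prod := by
  induction s using Multiset.induction_on with
  | empty => exact absurd rfl hs
  | cons a s ih =>
    simp only [Multiset.map_cons, Multiset.prod_cons]
    have hG : 0 < (s.map g).prod :=
      Multiset.prod_pos fun x hx ↦ by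
        obtain ⟨b, -, rfl⟩ := Multiset.mem_map.1 hx
        exact (hf b).trans_lt (hfg b)
    have hFG : (s.map f).prod ≤ (s.map g).prod := by
      by_cases hs0 : s = 0
      · simp [hs0]
      · exact (ih hs0).le
    calc f a * (s.map f).prod ≤ f a * (s.map g).prod := mul_le_mul_of_nonneg_left hFG (hf a)
      _ < g a * (s.map g).prod := mul_lt_mul_of_pos_right (hfg a) hG

/-- `‖∏ s‖ = ∏ ‖·‖` over a multiset of complex numbers. [folklore] -/
theorem norm_multiset_prod (s : Multiset ℂ) : ‖s.prod‖ = (s.map fun x ↦ ‖x‖).prod := by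
  induction s using Multiset.induction_on with
  | empty => simp
  | cons a s ih => simp [ih]

/-- The key strict inequality (de Bruijn 1950, proof of Thm. 3, case `Δᵢ = 0`): if `p` has only
real roots and positive degree, `λ > 0` and `Im ζ > 0`, then `‖p(ζ − iλ)‖ < ‖p(ζ + iλ)‖`.
[cite: Bruijn1950, Thm. 3] -/
theorem norm_eval_sub_lt_norm_eval_add {p : Polynomial ℂ} (hp : 0 < p.natDegree)
    (hreal : ∀ z : ℂ, p.IsRoot z → z.im = 0) {lam : ℝ} (hlam : 0 < lam) {ζ : ℂ} (hζ : 0 < ζ.im) :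
    ‖p.eval (ζ - I * lam)‖ < ‖p.eval (ζ + I * lam)‖ := by
  have hsplit : p.Splits := IsAlgClosed.splits p
  have hp0 : p ≠ 0 := by rintro rfl; simp at hp
  rw [hsplit.eval_eq_prod_roots (ζ - I * lam), hsplit.eval_eq_prod_roots (ζ + I * lam),
    norm_mul, norm_mul, norm_multiset_prod, norm_multiset_prod, Multiset.map_map, Multiset.map_map]
  have hlc : 0 < ‖p.leadingCoeff‖ := norm_pos_iff.2 (leadingCoeff_ne_zero.2 hp0)
  refine mul_lt_mul_of_pos_left ?_ hlc
  -- restrict to the roots, which are real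
  have hroots : ∀ b ∈ p.roots, b.im = 0 := fun b hb ↦ hreal b ((mem_roots hp0).1 hb)
  have hne : p.roots ≠ 0 := hsplit.roots_ne_zero hp.ne'
  -- replace each root by its real part
  have hcongr : ∀ (w : ℂ), (p.roots.map (Function.comp norm (w - ·))) =
      p.roots.map (fun b ↦ ‖w - ((b.re : ℝ) : ℂ)‖) := fun w ↦
    Multiset.map_congr rfl fun b hb ↦ by
      simp only [Function.comp_apply]
      congr 2
      exact Complex.ext (by simp) (by simp [hroots b hb])
  rw [hcongr, hcongr]
  refine multiset_prod_map_lt _ hne _ _ (fun b ↦ norm_nonneg _) fun b ↦ ?_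
  simpa [sub_sub] using norm_sub_lt_norm_add hζ b.re hlam

/-- de Bruijn's operator (Thm. 3 with `ξ = 1`; (2.3) with `N = 1`): `p ↦ p(z + iλ) + p(z − iλ)`,
as a polynomial (`taylor a p = p(X + a)`). [cite: Bruijn1950, Thm. 3] -/
def jensenShift (lam : ℝ) (p : Polynomial ℂ) : Polynomial ℂ :=
  taylor (I * lam) p + taylor (-(I * lam)) p

/-- `(jensenShift λ p)(z) = p(z + iλ) + p(z − iλ)`. [folklore] -/
theorem eval_jensenShift (lam : ℝ) (p : Polynomial ℂ) (z : ℂ) :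
    (jensenShift lam p).eval z = p.eval (z + I * lam) + p.eval (z - I * lam) := by
  simp [jensenShift, taylor_eval, sub_eq_add_neg]

/-- `jensenShift λ p ≠ 0` for `p ≠ 0` (its coefficient in degree `deg p` is `2 · lc(p)`). [folklore] -/
theorem jensenShift_ne_zero (lam : ℝ) {p : Polynomial ℂ} (hp : p ≠ 0) : jensenShift lam p ≠ 0 := by
  intro h
  have hc := congrArg (fun q : Polynomial ℂ ↦ q.coeff p.natDegree) h
  simp only [jensenShift, coeff_add, coeff_taylor_natDegree, coeff_zero] at hc
  have : p.leadingCoeff = 0 := by linear_combination hc / 2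
  exact hp (leadingCoeff_eq_zero.1 this)

/-- **de Bruijn 1950, Thm. 3** (case `Δᵢ = 0`, `ξ = 1`; p. 201). If the complex polynomial `p ≠ 0`
has only real roots and `λ ≥ 0`, then `p(z + iλ) + p(z − iλ)` is a non-zero polynomial with only
real roots. (For `Im ζ > 0` one has `‖p(ζ + iλ)‖ > ‖p(ζ − iλ)‖` factor by factor, so `ζ` is not
a root; symmetrically for `Im ζ < 0`.) [cite: Bruijn1950, Thm. 3] -/
theorem thm3_real {p : Polynomial ℂ} (hp : p ≠ 0) (hreal : ∀ z : ℂ, p.IsRoot z → z.im = 0)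
    {lam : ℝ} (hlam : 0 ≤ lam) :
    jensenShift lam p ≠ 0 ∧ ∀ z : ℂ, (jensenShift lam p).IsRoot z → z.im = 0 := by
  refine ⟨jensenShift_ne_zero lam hp, fun z hz ↦ ?_⟩
  rw [IsRoot, eval_jensenShift] at hz
  rcases hlam.eq_or_lt with rfl | hlam'
  · -- `λ = 0`: `2 p(z) = 0`
    simp only [ofReal_zero, mul_zero, add_zero, sub_zero] at hz
    exact hreal z (by rw [IsRoot]; linear_combination hz / 2)
  by_cases hdeg : p.natDegree = 0
  · -- constant polynomial: `2c = 0` forces `c = 0`, contradiction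
    obtain ⟨c, rfl⟩ : ∃ c, p = Polynomial.C c := ⟨_, eq_C_of_natDegree_eq_zero hdeg⟩
    simp only [eval_C] at hz
    exact absurd (show c = 0 by linear_combination hz / 2) (by simpa using hp)
  have hdeg' : 0 < p.natDegree := Nat.pos_of_ne_zero hdeg
  -- norms of the two summands agree
  have hnorm : ‖p.eval (z + I * lam)‖ = ‖p.eval (z - I * lam)‖ := by
    rw [show p.eval (z + I * lam) = -p.eval (z - I * lam) by linear_combination hz, norm_neg]
  by_contra hzim
  rcases lt_or_gt_of_ne hzim with hneg | hpos
  · -- `Im z < 0`: apply the inequality to the polynomial `p(-X)` (roots still real) at `-z`.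
    set q : Polynomial ℂ := p.comp (-X) with hq
    have hqdeg : 0 < q.natDegree := by
      simp only [hq, natDegree_comp, natDegree_neg, natDegree_X, mul_one]; exact hdeg'
    have hqreal : ∀ w : ℂ, q.IsRoot w → w.im = 0 := fun w hw ↦ by
      have : p.IsRoot (-w) := by simpa [hq, IsRoot, eval_comp] using hw
      have := hreal _ this
      simpa using this
    have hw : 0 < (-z).im := by simp; linarith
    have hqe : ∀ w, q.eval w = p.eval (-w) := fun w ↦ by simp [hq, eval_comp]
    have key := norm_eval_sub_lt_norm_eval_add hqdeg hqreal hlam' hw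
    rw [hqe, hqe, show -(-z - I * (lam : ℂ)) = z + I * lam by ring,
      show -(-z + I * (lam : ℂ)) = z - I * lam by ring] at key
    exact absurd hnorm key.ne
  · have key := norm_eval_sub_lt_norm_eval_add hdeg' hreal hlam' hpos
    exact absurd hnorm key.ne'

/-- Iterating de Bruijn's operator: `(jensenShift λ)^[M] p` is non-zero with only real roots when
`p ≠ 0` has only real roots (de Bruijn 1950, Thm. 4 with `φ(u) = (1 + u)^M`, `Δ = 0`).
[cite: Bruijn1950, Thm. 4] -/
theorem iterate_jensenShift_real {p : Polynomial ℂ} (hp : p ≠ 0)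
    (hreal : ∀ z : ℂ, p.IsRoot z → z.im = 0) {lam : ℝ} (hlam : 0 ≤ lam) (M : ℕ) :
    (jensenShift lam)^[M] p ≠ 0 ∧ ∀ z : ℂ, ((jensenShift lam)^[M] p).IsRoot z → z.im = 0 := by
  induction M with
  | zero => exact ⟨hp, hreal⟩
  | succ M ih =>
    rw [Function.iterate_succ_apply']
    exact thm3_real ih.1 ih.2 hlam

end DeBruijn1950

end Literature.Analysis.Complex
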